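/-
Copyright: b2b-lace cell (CriticalPhenomena). Text-final: enum1-g72 desk draft 3 (ceb7ff6ef6d4fe46) in its T3-RIGHT-first form
d3R (enum1-g73, c915aa8d3a207f3c: it imports the right twin `NobleWeightedDiagRight` and uses that module's public
`wtOpenBubbleAt` ∕ `perc_tau_neg` in place of a written-out Φ and of a private copy) + header relabel ONLY, filed by the
enum1 seat under REFEREE v219 R1416 (T3 booking) and ORDERS v222 (b) (T1 → T3-RIGHT → T3-LEFT) after T1 `NobleWeightedDiagSplit`
(c11638786dac7132) and T3-RIGHT `NobleWeightedDiagRight` landed and were built.  Diagonal normal forms of the left-trivial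
pieces `b = 1, 2`, the weight moved along a line, product bounds `𝓣 ≤ 𝓣*`, `𝓢 ≤ 𝓢*`, direction transport.
No numeral; d-generic; no cited hypothesis.
-/
import Literature.Probability.FitznerVanDerHofstad2017.NobleWeightedDiagSplit
import Literature.Probability.FitznerVanDerHofstad2017.NobleWeightedDiagRight
import Literature.Probability.FitznerVanDerHofstad2017.NobleEntryAbarIotaZeroTwoLower
import Literature.Probability.FitznerVanDerHofstad2017.NoblePercLettersSymm
import Literature.Probability.FitznerVanDerHofstad2017.NobleF3WeightedLine
import HarnessLib

/-!
# [FvdH17] Lemma 5.1 (second version), left-trivial configurations: the DIAGONAL `t = e_ι` of classes `b = 1, 2` — normal forms, the weight split, product bounds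

CITATION HEADER (PLACEMENT v2). This module is part of a certified REPRODUCTION of:
R. Fitzner, R. van der Hofstad, *Mean-field behavior for nearest-neighbor percolation in `d > 10`*, Electron. J.
Probab. **22** (2017) no. 43 [FvdH17] (arXiv:1506.07977v2): §4.4 (4.65) (p. 43), Lemma 5.1 second version (p. 50),
§4.2 (4.1), (4.7)–(4.9), (4.14)–(4.17) (pp. 34–36: `𝓣 ≤ 𝓣*`, `𝓢 ≤ 𝓢*`), App. B Tables "definition of `P^b(x,y)`"
(p. 73), "definition of `A^{ι,a,b}`" (p. 75), "`P^{E,b}`" (p. 47) and the display "double-open triangle `Ā^{ι,a,b}`"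
(p. 78), App. C.1 Case a) (p. 79: the algebra `‖x‖₂² = ‖w‖₂² + ‖x−w‖₂² + 2wᵀ(x−w)` of a weight moved along a
line), §3.5 "Symmetry of the model" (p. 32).
Origin: build `lace` (host summit CriticalPhenomena), enumeration seat; the left twin of `NobleWeightedDiagRight`.

WHAT THIS FILE DOES.  `rawLDiag Ab En ι b = Σ_{x,z} ‖x‖₂² Ab^{ι,0,b}(0,0,e_ι,z) En_b(e_ι−x, z−x)` (`NobleWeightedDiagSplit`)
is the diagonal `t = e_ι` of the left-trivial sum `R_L(ι,b)` of `NobleWeightedN1Assembly` (start triangle trivial,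
`u = w = 0`; the exit-triangle vertex `t` pinned at the top `e_ι` of the first pivotal bond; weight on the far end
`x`).  For the tabulated families `Ab = blockAbar' L` and `En = blockPEn L` (`P^{E,b}(s,s') = (1−δ_{s',0}) P^{S,b}`):
* NORMAL FORMS (every letter table `L`, IDENTITIES; reindexing `(y, w) := (z − e_ι, z − x)`):
  `rawLDiag (blockAbar' L) (blockPEn L) ι 2 = Σ_y Λ^ι_L(y + e_ι) · LWTT^ι_{L,2}(y)` (`rawLDiag_two_eq`) and
  `rawLDiag (blockAbar' L) (blockPEn L) ι 1 = Σ_y Λ¹^ι_L(y + e_ι) · LWTT^ι_{L,1̲}(y)` (`rawLDiag_one_eq`), with the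
  one-line letter `Λ^ι_L(z) := T*_{1,1̲,0}(−z, e_ι−z, e_ι−z)` (row `Ā^{ι,0,2}` p. 78 at `x = e_ι`; `diagLLetter`,
  `= τ_{≥1}(−z) τ_{1̲}(e_ι) τ_{≥0}(0)`), the class-`1` letter `Λ¹^ι_L(z) := p⁻¹ (1−δ_{z,0}) (𝓣_{1̲,1̲,2}(e_ι,z,0) +
  𝓢_{1̲,1,1̲,1}(e_ι,e_ι,z,0))` (row `A^{ι,0,1}` p. 75 at `x = e_ι`, `Ā = A/p`; `diagLLetterOne`), and the exit triangle
  of middle index `j` (`j = 2` for class 2, `j = 1̲` for class 1) at middle displacement `y` weighted at its FAR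
  vertex: `LWTT^ι_{L,j}(y) := Σ_w ‖y+e_ι−w‖₂² F_{L,j}(y;w)`, `F_{L,j}(y;w) := (1−δ_{w,0})(1−δ_{w−y,0}) 𝓣_{1,j,1}(w−y,w,0)`
  (`diagLWTT`, `diagLIntegrand`) — the right twin's triangle families (`NobleWeightedDiagRight.diagWTT ∕ diagWTB`)
  with the weight displaced by `y + e_ι`.
* THE WEIGHT SPLIT (every `L`, every `j`, identities in `[0,∞]`, App. C.1 Case a) algebra): INNER form
  `LWTT^ι_j(y) + 2·X₋(y) = LW_j(y) + TT_j(y) + 2·X₊(y)` (`diagLWTT_inner_split`) with `LW_j(y) := Σ_w ‖y−w‖₂² F_j(y;w)`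
  (weight on the INNER displacement; `diagLW`), `TT_j(y) := Σ_w F_j(y;w)` (`diagLTT`), `X_±(y) := Σ_w ⟨y−w,e_ι⟩_± F_j(y;w)`
  (`diagLCrossPos ∕ diagLCrossNeg`); and the PAIRING form against a reflection-symmetric majorant
  (`tsum_wt_add_stepVec_sub_mul`).
* at `L = Letters.perc d p` (PRODUCT BOUNDS `𝓣 ≤ 𝓣*`, `𝓢 ≤ 𝓢*`): `Λ^ι(z) = p · τ₁(z)` exactly (`perc_diagLLetter_eq`),
  `Λ¹^ι(z) ≤ (1−δ_{z,0}) τ_{1̲}(z − e_ι) τ₂(z)` (`perc_diagLLetterOne_le`; the `𝓢`-addend VANISHES: its second line is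
  the closed path `e_ι → e_ι` of length `≥ 1`, `{v ←1→ v} = ∅`), `LW_j(y) ≤ τ_j(y) · Φ(y)`, `TT_j(y) ≤ τ_j(y) · Φ⁰(y)`
  with `Φ(y) = Σ_w ‖w‖₂² τ₁(w) τ₁(w−y)` (the right twin's `wtOpenBubbleAt`, imported) and the pointwise open
  bubble `Φ⁰(y) := Σ_w τ₁(w) τ₁(w−y)` (`openBubbleAt`), the structural-drop form `LWTT^ι_j(y) ≤ τ_j(y) · (Φ(y) +
  (1 + ⟨y,e_ι⟩₊) Φ⁰(y))`, the per-direction normal forms `rawLDiag … ι 2 = p Σ_y τ₁(y+e_ι) LWTT^ι_2(y)`,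
  `rawLDiag … ι 1 ≤ Σ_y (1−δ_{y+e_ι,0}) τ_{1̲}(y) τ₂(y+e_ι) LWTT^ι_{1̲}(y)`, and the direction-summed INNER identity of
  class 2 against `K̃(y) := p · Σ_ι τ₁(y + e_ι)` (`diagKtilde`, `perc_sum_rawLDiag_two_inner_split`).
INDEX PLACEMENT: `≥2` sits on `τ₂(y)` (class 2: the exit triangle's middle side `e_ι + · → z`; class 1: the closing
side `z → 0` of `𝓣_{1̲,1̲,2}(e_ι,z,0)`), never on the pivotal bond.  No inequality between different letters of print is
asserted beyond `𝓣 ≤ 𝓣*`, `𝓢 ≤ 𝓢*`; the split identities are algebra over the tree's objects (one ADDEND of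
`NobleWeightedDiagSplit`'s split identity; no bound on a whole piece of (4.65) is asserted); no numeral; d-generic;
nothing landed is modified; no cited hypothesis.
-/

noncomputable section

namespace Literature.Probability.FitznerVanDerHofstad2017

open scoped BigOperators ENNReal
open Literature.Probability.LatticeModels Literature.Probability.Percolation
open Literature.Probability.FitznerVanDerHofstad2017.BlockSummation
open Literature.Probability.FitznerVanDerHofstad2017.NobleBlocks
open Literature.Barriers.CriticalPhenomena (euclidNorm euclidNorm_nonneg)
open Literature.Probability.RandomPlanarGeometry.SAW.Zd (normSq normSq_nonneg)

variable {d : ℕ}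

local notation "𝐞" => Literature.Probability.Percolation.stepVec

/-! ## 0. Weight algebra along a line (App. C.1 Case a)): the pairing identity and the inner split -/

section PairingStepVec

/-- `‖z‖₂²` in the weight currency is `ofReal |z|²`. [folklore] -/
private theorem wt_eq_ofReal_normSq (z : Site d) : wt z = ENNReal.ofReal (normSq z) := by
  rw [wt, euclidNorm_sq_eq_normSq]

/-- `max(a,0) − max(−a,0) = a`. [folklore] -/
private theorem max_zero_sub_max_neg_zero (a : ℝ) : max a 0 - max (-a) 0 = a := by
  rcases le_total 0 a with h | h
  · rw [max_eq_left h, max_eq_right (by linarith)]; ring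
  · rw [max_eq_right h, max_eq_left (by linarith)]; ring

/-- Real form of `wt_pair_stepVec`:
`|y−w+e|² + |w+e|² + 2 max(−⟨e,y⟩,0) = |y−w|² + |w|² + 2 (1 + max(⟨e,y⟩,0))`. [folklore] -/
private theorem normSq_pair_stepVec (y w : Site d) (ι : Fin d × Bool) :
    normSq (y - w + 𝐞 ι) + normSq (w + 𝐞 ι) + 2 * max (-(dirDot ι y)) 0 =
      normSq (y - w) + normSq w + 2 * (1 + max (dirDot ι y) 0) := by
  have h1 : normSq (y - w + 𝐞 ι) = normSq (y - w) + 2 * dirDot ι (y - w) + 1 := normSq_add_stepVec (y - w) ι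
  have h2 : normSq (w + 𝐞 ι) = normSq w + 2 * dirDot ι w + 1 := normSq_add_stepVec w ι
  have h3 : dirDot ι (y - w) = dirDot ι y - dirDot ι w := dirDot_sub ι y w
  have h4 := max_zero_sub_max_neg_zero (dirDot ι y)
  rw [h1, h2, h3]
  linarith

/-- **Pointwise weight identity (a weight moved along a unit step, paired with its reflection)**:
`‖y−w+e‖₂² + ‖w+e‖₂² + 2⟨y,e⟩₋ = ‖y−w‖₂² + ‖w‖₂² + 2(1 + ⟨y,e⟩₊)` in `[0,∞]`, `e = e_ι`.
[cite: FitznerVanDerHofstad2017, App. C.1 Case a) "‖x‖₂² = ‖w‖₂² + ‖x−w‖₂² + wᵀ(x−w) (sic)" (arXiv:1506.07977v2 p. 79)] -/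
theorem wt_pair_stepVec (y w : Site d) (ι : Fin d × Bool) :
    wt (y - w + 𝐞 ι) + wt (w + 𝐞 ι) + 2 * ENNReal.ofReal (max (-(dirDot ι y)) 0) =
      wt (y - w) + wt w + 2 * ENNReal.ofReal (1 + max (dirDot ι y) 0) := by
  have hm : 0 ≤ max (-(dirDot ι y)) 0 := le_max_right _ _
  have hp : 0 ≤ 1 + max (dirDot ι y) 0 := by positivity
  have e2 : ∀ a : ℝ, 0 ≤ a → (2 : ℝ≥0∞) * ENNReal.ofReal a = ENNReal.ofReal (2 * a) := fun a _ => by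
    rw [ENNReal.ofReal_mul zero_le_two, ENNReal.ofReal_ofNat]
  rw [wt_eq_ofReal_normSq, wt_eq_ofReal_normSq, wt_eq_ofReal_normSq, wt_eq_ofReal_normSq, e2 _ hm, e2 _ hp,
    ← ENNReal.ofReal_add (normSq_nonneg _) (normSq_nonneg _),
    ← ENNReal.ofReal_add (add_nonneg (normSq_nonneg _) (normSq_nonneg _)) (mul_nonneg zero_le_two hm),
    ← ENNReal.ofReal_add (normSq_nonneg _) (normSq_nonneg _),
    ← ENNReal.ofReal_add (add_nonneg (normSq_nonneg _) (normSq_nonneg _)) (mul_nonneg zero_le_two hp),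
    normSq_pair_stepVec]

/-- **The pairing identity**: for `G : ℤ^d → [0,∞]` with `G(y − w) = G(w)`,
`Σ_w ‖y+e−w‖₂² G(w) + ⟨y,e⟩₋ Σ_w G(w) = Σ_w ‖w‖₂² G(w) + (1 + ⟨y,e⟩₊) Σ_w G(w)` in `[0,∞]` (pair `w` with `y − w`).
[cite: FitznerVanDerHofstad2017, App. C.1 Case a) "‖x‖₂² = ‖w‖₂² + ‖x−w‖₂² + wᵀ(x−w) (sic) and spatial symmetry" (arXiv:1506.07977v2 p. 79)] -/
theorem tsum_wt_add_stepVec_sub_mul (G : Site d → ℝ≥0∞) (y : Site d) (hG : ∀ w, G (y - w) = G w)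
    (ι : Fin d × Bool) :
    ∑' w, wt (y + 𝐞 ι - w) * G w + ENNReal.ofReal (max (-(dirDot ι y)) 0) * ∑' w, G w =
      ∑' w, wt w * G w + ENNReal.ofReal (1 + max (dirDot ι y) 0) * ∑' w, G w := by
  have flipL : ∑' w, wt (y + 𝐞 ι - w) * G w = ∑' w, wt (w + 𝐞 ι) * G w := by
    rw [← (Equiv.subLeft y).tsum_eq]
    refine tsum_congr fun w => ?_
    simp only [Equiv.subLeft_apply, hG]
    congr 1
    congr 1
    abel
  have flipR : ∑' w, wt w * G w = ∑' w, wt (y - w) * G w := by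
    rw [← (Equiv.subLeft y).tsum_eq]
    exact tsum_congr fun w => by simp only [Equiv.subLeft_apply, hG]
  have hL : 2 * (∑' w, wt (y + 𝐞 ι - w) * G w + ENNReal.ofReal (max (-(dirDot ι y)) 0) * ∑' w, G w)
      = ∑' w, (wt (y - w + 𝐞 ι) + wt (w + 𝐞 ι) + 2 * ENNReal.ofReal (max (-(dirDot ι y)) 0)) * G w := by
    have : 2 * (∑' w, wt (y + 𝐞 ι - w) * G w + ENNReal.ofReal (max (-(dirDot ι y)) 0) * ∑' w, G w)
        = ∑' w, wt (y + 𝐞 ι - w) * G w + ∑' w, wt (w + 𝐞 ι) * G w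
          + 2 * ENNReal.ofReal (max (-(dirDot ι y)) 0) * ∑' w, G w := by rw [← flipL]; ring
    rw [this, ← ENNReal.tsum_mul_left, ← ENNReal.tsum_add, ← ENNReal.tsum_add]
    refine tsum_congr fun w => ?_
    rw [add_sub_right_comm]
    ring
  have hR : 2 * (∑' w, wt w * G w + ENNReal.ofReal (1 + max (dirDot ι y) 0) * ∑' w, G w)
      = ∑' w, (wt (y - w) + wt w + 2 * ENNReal.ofReal (1 + max (dirDot ι y) 0)) * G w := by
    have : 2 * (∑' w, wt w * G w + ENNReal.ofReal (1 + max (dirDot ι y) 0) * ∑' w, G w)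
        = ∑' w, wt (y - w) * G w + ∑' w, wt w * G w
          + 2 * ENNReal.ofReal (1 + max (dirDot ι y) 0) * ∑' w, G w := by rw [← flipR]; ring
    rw [this, ← ENNReal.tsum_mul_left, ← ENNReal.tsum_add, ← ENNReal.tsum_add]
    exact tsum_congr fun w => by ring
  refine (ENNReal.mul_right_inj two_ne_zero ENNReal.ofNat_ne_top).mp ?_
  rw [hL, hR]
  exact tsum_congr fun w => by rw [wt_pair_stepVec]

/-- **The inner pointwise split**: `‖z+e‖₂² + 2⟨z,e⟩₋ = ‖z‖₂² + 1 + 2⟨z,e⟩₊` in `[0,∞]`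
(`|z+e|² = |z|² + 2⟨e,z⟩ + 1` with the signed cross term separated into its two parts; no pairing, no symmetry).
[cite: FitznerVanDerHofstad2017, App. C.1 Case a) "‖x‖₂² = ‖w‖₂² + ‖x−w‖₂² + wᵀ(x−w) (sic)" (arXiv:1506.07977v2 p. 79)] -/
theorem wt_add_stepVec_posneg (z : Site d) (ι : Fin d × Bool) :
    wt (z + 𝐞 ι) + 2 * ENNReal.ofReal (max (-(dirDot ι z)) 0) =
      wt z + 1 + 2 * ENNReal.ofReal (max (dirDot ι z) 0) := by
  have hm : 0 ≤ max (-(dirDot ι z)) 0 := le_max_right _ _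
  have hp : 0 ≤ max (dirDot ι z) 0 := le_max_right _ _
  have e2 : ∀ a : ℝ, 0 ≤ a → (2 : ℝ≥0∞) * ENNReal.ofReal a = ENNReal.ofReal (2 * a) := fun a _ => by
    rw [ENNReal.ofReal_mul zero_le_two, ENNReal.ofReal_ofNat]
  have h1 : normSq (z + 𝐞 ι) = normSq z + 2 * dirDot ι z + 1 := normSq_add_stepVec z ι
  have h3 := max_zero_sub_max_neg_zero (dirDot ι z)
  rw [wt_eq_ofReal_normSq, wt_eq_ofReal_normSq, e2 _ hm, e2 _ hp, ← ENNReal.ofReal_one,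
    ← ENNReal.ofReal_add (normSq_nonneg _) (mul_nonneg zero_le_two hm),
    ← ENNReal.ofReal_add (normSq_nonneg _) zero_le_one,
    ← ENNReal.ofReal_add (add_nonneg (normSq_nonneg _) zero_le_one) (mul_nonneg zero_le_two hp)]
  congr 1
  rw [h1]
  linarith

/-- **The inner form of the weight split along a line**, against any `G : ℤ^d → [0,∞]` (no symmetry, no pairing):
`Σ_w ‖y+e−w‖₂² G(w) + 2 Σ_w ⟨y−w,e⟩₋ G(w) = Σ_w ‖y−w‖₂² G(w) + Σ_w G(w) + 2 Σ_w ⟨y−w,e⟩₊ G(w)` in `[0,∞]`.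
[cite: FitznerVanDerHofstad2017, App. C.1 Case a) "‖x‖₂² = ‖w‖₂² + ‖x−w‖₂² + wᵀ(x−w) (sic)" (arXiv:1506.07977v2 p. 79)] -/
theorem tsum_wt_add_stepVec_sub_mul_inner (G : Site d → ℝ≥0∞) (y : Site d) (ι : Fin d × Bool) :
    ∑' w, wt (y + 𝐞 ι - w) * G w + 2 * ∑' w, ENNReal.ofReal (max (-(dirDot ι (y - w))) 0) * G w =
      ∑' w, wt (y - w) * G w + ∑' w, G w + 2 * ∑' w, ENNReal.ofReal (max (dirDot ι (y - w)) 0) * G w := by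
  have key : ∀ w, wt (y + 𝐞 ι - w) * G w + 2 * (ENNReal.ofReal (max (-(dirDot ι (y - w))) 0) * G w) =
      wt (y - w) * G w + G w + 2 * (ENNReal.ofReal (max (dirDot ι (y - w)) 0) * G w) := fun w => by
    rw [add_sub_right_comm]
    calc wt (y - w + 𝐞 ι) * G w + 2 * (ENNReal.ofReal (max (-(dirDot ι (y - w))) 0) * G w)
        = (wt (y - w + 𝐞 ι) + 2 * ENNReal.ofReal (max (-(dirDot ι (y - w))) 0)) * G w := by ring
      _ = (wt (y - w) + 1 + 2 * ENNReal.ofReal (max (dirDot ι (y - w)) 0)) * G w := by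
          rw [wt_add_stepVec_posneg]
      _ = wt (y - w) * G w + G w + 2 * (ENNReal.ofReal (max (dirDot ι (y - w)) 0) * G w) := by ring
  calc ∑' w, wt (y + 𝐞 ι - w) * G w + 2 * ∑' w, ENNReal.ofReal (max (-(dirDot ι (y - w))) 0) * G w
      = ∑' w, (wt (y + 𝐞 ι - w) * G w + 2 * (ENNReal.ofReal (max (-(dirDot ι (y - w))) 0) * G w)) := by
        rw [ENNReal.tsum_add, ENNReal.tsum_mul_left]
    _ = ∑' w, (wt (y - w) * G w + G w + 2 * (ENNReal.ofReal (max (dirDot ι (y - w)) 0) * G w)) :=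
        tsum_congr key
    _ = ∑' w, wt (y - w) * G w + ∑' w, G w + 2 * ∑' w, ENNReal.ofReal (max (dirDot ι (y - w)) 0) * G w := by
        rw [ENNReal.tsum_add, ENNReal.tsum_add, ENNReal.tsum_mul_left]

end PairingStepVec

/-! ## A. The letters at the left diagonal and the normal forms (every letter table `L`) -/

/-- **The one-line letter of the left-trivial diagonal of class `2`**: `Λ^ι_L(z) := T*_{1,1̲,0}(−z, e_ι−z, e_ι−z)` —
the row `Ā^{ι,0,2}(0,v,x,y) = δ_{0,v} T*_{1,1̲,0}(−y, e−y, x−y)` read at the pinned exit vertex `x = e_ι` (`y = z`):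
a line `0 → z` of length `≥ 1`, the pivotal bond `(0,e_ι)` exact, and a trivial point-to-itself third factor.
[cite: FitznerVanDerHofstad2017, App. B, display "double-open triangle Ā^{ι,a,b}", row Ā^{ι,0,2} (arXiv:1506.07977v2 p. 78)] -/
def diagLLetter (L : Letters d) (ι : Fin d × Bool) (z : Site d) : ℝ≥0∞ :=
  L.Tst (.ge 1) (.eq 1) (.ge 0) (-z) (𝐞 ι - z) (𝐞 ι - z)

/-- **The one-line letter of the left-trivial diagonal of class `1`**:
`Λ¹^ι_L(z) := p⁻¹ · (1−δ_{z,0}) · (𝓣_{1̲,1̲,2}(e_ι,z,0) + 𝓢_{1̲,1,1̲,1}(e_ι,e_ι,z,0))` — the row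
`A^{ι,0,1}(0,v,x,y) = δ_{0,v}(1−δ_{y,v})(δ_{x,e} 𝓣_{1̲,1̲,2}(e,y,0) + 𝓢_{1̲,1,1̲,1}(e,x,y,0))` of the Table for `A^{ι,a,b}`
read at `x = e_ι` (`y = z`), divided by `p` (`Ā^{ι,a,1} = (1/p) A^{ι,a,1}`).
[cite: FitznerVanDerHofstad2017, App. B Table "definition of A^{ι,a,b}", row a=0,b=1 (arXiv:1506.07977v2 p. 75); display "Ā^{ι,a,1} = (1/p) A^{ι,a,1}" (p. 78)] -/
def diagLLetterOne (L : Letters d) (ι : Fin d × Bool) (z : Site d) : ℝ≥0∞ :=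
  L.p⁻¹ * (kdc z 0 * (L.T (.eq 1) (.eq 1) (.ge 2) (𝐞 ι) z 0 + L.S (.eq 1) (.ge 1) (.eq 1) (.ge 1) (𝐞 ι) (𝐞 ι) z 0))

/-- The exit-triangle integrand of middle index `j` at middle displacement `y`, vertex `w`:
`F_{L,j}(y;w) := (1−δ_{w,0})(1−δ_{w−y,0}) 𝓣_{1,j,1}(w−y, w, 0)` (Table `P^b`: row `b ≥ 2`, `y ≠ 0` for `j = 2`; row
`b = 1`, `y ≠ 0` for `j = 1̲`; the factor `(1−δ_{w,0})` is the exit factor of `P^{E,b}`).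
[cite: FitznerVanDerHofstad2017, App. B Table "definition of P^b(x,y)", rows b = 1, b ≥ 2 (arXiv:1506.07977v2 p. 73); §5.1 Table "P^{E,b}" (p. 47)] -/
def diagLIntegrand (L : Letters d) (j : LenIdx) (y w : Site d) : ℝ≥0∞ :=
  kdc w 0 * (kdc (w - y) 0 * L.T (.ge 1) j (.ge 1) (w - y) w 0)

/-- **`TT_j(y) := Σ_w (1−δ_{w,0})(1−δ_{w−y,0}) 𝓣_{1,j,1}(w−y, w, 0)`** — the unweighted closed exit triangle of middle
index `j` at middle displacement `y`. [cite: FitznerVanDerHofstad2017, App. B Table "definition of P^b(x,y)" (arXiv:1506.07977v2 p. 73); Lemma 5.1 second version (p. 50)] -/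
def diagLTT (L : Letters d) (j : LenIdx) (y : Site d) : ℝ≥0∞ :=
  ∑' w, diagLIntegrand L j y w

/-- **`LWTT^ι_j(y) := Σ_w ‖y + e_ι − w‖₂² F_j(y;w)`** — the exit triangle weighted at its FAR vertex (`x = z − w`,
`z = y + e_ι`). [cite: FitznerVanDerHofstad2017, Lemma 5.1 second version (arXiv:1506.07977v2 p. 50); App. B Table "definition of P^b(x,y)" (p. 73)] -/
def diagLWTT (L : Letters d) (j : LenIdx) (ι : Fin d × Bool) (y : Site d) : ℝ≥0∞ :=
  ∑' w, wt (y + 𝐞 ι - w) * diagLIntegrand L j y w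

/-- **`LW_j(y) := Σ_w ‖y − w‖₂² F_j(y;w)`** — the same triangle weighted on its INNER displacement `y − w`.
[cite: FitznerVanDerHofstad2017, Lemma 5.1 second version (arXiv:1506.07977v2 p. 50); App. C.1 Case a) (p. 79)] -/
def diagLW (L : Letters d) (j : LenIdx) (y : Site d) : ℝ≥0∞ :=
  ∑' w, wt (y - w) * diagLIntegrand L j y w

/-- The positive part of the cross term: `X₊(y) := Σ_w ⟨y−w, e_ι⟩₊ F_j(y;w)`.
[cite: FitznerVanDerHofstad2017, App. C.1 Case a) "wᵀ(x−w)" (arXiv:1506.07977v2 p. 79)] -/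
def diagLCrossPos (L : Letters d) (j : LenIdx) (ι : Fin d × Bool) (y : Site d) : ℝ≥0∞ :=
  ∑' w, ENNReal.ofReal (max (dirDot ι (y - w)) 0) * diagLIntegrand L j y w

/-- The negative part of the cross term: `X₋(y) := Σ_w ⟨y−w, e_ι⟩₋ F_j(y;w)`.
[cite: FitznerVanDerHofstad2017, App. C.1 Case a) "wᵀ(x−w)" (arXiv:1506.07977v2 p. 79)] -/
def diagLCrossNeg (L : Letters d) (j : LenIdx) (ι : Fin d × Bool) (y : Site d) : ℝ≥0∞ :=
  ∑' w, ENNReal.ofReal (max (-(dirDot ι (y - w))) 0) * diagLIntegrand L j y w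

/-- **The pointwise open bubble** `Φ⁰_L(y) := Σ_w τ_{≥1}(w) τ_{≥1}(w − y)` (two lines `0 → w → y` of length `≥ 1`,
no weight). [cite: FitznerVanDerHofstad2017, §4.2 (4.7), (4.14)–(4.17) (arXiv:1506.07977v2 pp. 34–36)] -/
def openBubbleAt (L : Letters d) (y : Site d) : ℝ≥0∞ :=
  ∑' w, L.tau (.ge 1) w * L.tau (.ge 1) (w - y)

/-- **`K̃_L(y) := p · Σ_ι τ_{≥1}(y + e_ι)`** — the direction sum of the evaluated one-line letters of class `2`
(see `perc_diagLLetter_eq`). [cite: FitznerVanDerHofstad2017, §4.2 (4.1) (arXiv:1506.07977v2 p. 34); App. B row Ā^{ι,0,2} (p. 78)] -/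
def diagKtilde (L : Letters d) (y : Site d) : ℝ≥0∞ :=
  L.p * ∑ ι : Fin d × Bool, L.tau (.ge 1) (y + 𝐞 ι)

/-- `Λ^ι_L(z) = τ_{≥1}(−z) · (τ_{1̲}(e_ι) · τ_{≥0}(0))` (`T*` unfolded: `(e−z) − (−z) = e`, `(e−z) − (e−z) = 0`).
[cite: FitznerVanDerHofstad2017, §4.2 (4.7)–(4.8) (arXiv:1506.07977v2 p. 34); App. B row Ā^{ι,0,2} (p. 78)] -/
theorem diagLLetter_eq (L : Letters d) (ι : Fin d × Bool) (z : Site d) :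
    diagLLetter L ι z = L.tau (.ge 1) (-z) * (L.tau (.eq 1) (𝐞 ι) * L.tau (.ge 0) 0) := by
  simp only [diagLLetter, Letters.Tst, Letters.Bst, sub_neg_eq_add, sub_add_cancel, sub_self, mul_assoc]

/-- Row `(0,2)` of `Ā'^ι = Ā^ι` at the left diagonal: `Ā^{ι,0,2}(0,0,e_ι,z) = Λ^ι_L(z)`.
[cite: FitznerVanDerHofstad2017, App. B, display "double-open triangle Ā^{ι,a,b}", row Ā^{ι,0,2} (arXiv:1506.07977v2 p. 78)] -/
theorem blockAbar'_zero_two_diag (L : Letters d) (ι : Fin d × Bool) (z : Site d) :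
    blockAbar' L ι 0 2 0 0 (𝐞 ι) z = diagLLetter L ι z := by
  rw [blockAbar'_of_ne L ι (by decide), blockAbar, ofBase]
  simp only [sub_zero]
  rw [blockAbar₀_zero_two, kd_self, one_mul]
  rfl

/-- Row `(0,1)` of `Ā'^ι = Ā^ι = (1/p) A^ι` at the left diagonal: `Ā^{ι,0,1}(0,0,e_ι,z) = Λ¹^ι_L(z)`
(`δ_{0,0} = δ_{e,e} = 1`).
[cite: FitznerVanDerHofstad2017, App. B Table "definition of A^{ι,a,b}", row a=0,b=1 (arXiv:1506.07977v2 p. 75); display "Ā^{ι,a,1} = (1/p) A^{ι,a,1}" (p. 78)] -/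
theorem blockAbar'_zero_one_diag (L : Letters d) (ι : Fin d × Bool) (z : Site d) :
    blockAbar' L ι 0 1 0 0 (𝐞 ι) z = diagLLetterOne L ι z := by
  rw [blockAbar'_of_ne L ι (by decide), blockAbar, ofBase]
  simp only [sub_zero]
  rw [show blockAbar₀ L ι 0 1 0 (𝐞 ι) z = L.p⁻¹ * (kd (0 : Site d) 0 * kdc z 0 *
      (kd (𝐞 ι : Site d) (𝐞 ι) * L.T (.eq 1) (.eq 1) (.ge 2) (𝐞 ι) z 0 +
        L.S (.eq 1) (.ge 1) (.eq 1) (.ge 1) (𝐞 ι) (𝐞 ι) z 0)) from rfl,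
    kd_self, kd_self, one_mul, one_mul]
  rfl

/-- The class-`2` exit letter in `(1−δ)`-form: `(P^E−u⃗)_2(s,s') = (1−δ_{s',0}) (1−δ_{s,0}) 𝓣_{1,2,1}(s,s',0)`
(the `δ_{s',0} 𝓓_{2,2}(s)` addend of row `b ≥ 2` is killed by the exit factor `(1−δ_{s',0})`).
[cite: FitznerVanDerHofstad2017, App. B Table "definition of P^b(x,y)", row b ≥ 2 (arXiv:1506.07977v2 p. 73); §5.1 Table "P^{E,b}" (p. 47)] -/
theorem blockPEn_two_eq (L : Letters d) (s s' : Site d) :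
    blockPEn L 2 s s' = kdc s' 0 * (kdc s 0 * L.T (.ge 1) (.ge 2) (.ge 1) s s' 0) := by
  rw [blockPEn_of_ne_zero L (by decide), blockPE_of_ne_zero L (by decide), blockPS_two]
  by_cases hs' : s' = 0
  · subst hs'
    rw [kdc_self, zero_mul, zero_mul]
  · rw [kd_of_ne hs', kdc_of_ne hs']
    ring

/-- The class-`1` exit letter in `(1−δ)`-form: `(P^E−u⃗)_1(s,s') = (1−δ_{s',0}) (1−δ_{s,0}) 𝓣_{1,1̲,1}(s,s',0)`
(the `δ_{s',0} 𝓑_{3,1̲}(s,0)` addend of row `b = 1` is killed by the exit factor `(1−δ_{s',0})`).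
[cite: FitznerVanDerHofstad2017, App. B Table "definition of P^b(x,y)", row b = 1 (arXiv:1506.07977v2 p. 73); §5.1 Table "P^{E,b}" (p. 47)] -/
theorem blockPEn_one_eq (L : Letters d) (s s' : Site d) :
    blockPEn L 1 s s' = kdc s' 0 * (kdc s 0 * L.T (.ge 1) (.eq 1) (.ge 1) s s' 0) := by
  rw [blockPEn_of_ne_zero L (by decide), blockPE_of_ne_zero L (by decide), blockPS_one]
  by_cases hs' : s' = 0
  · subst hs'
    rw [kdc_self, zero_mul, zero_mul]
  · rw [kd_of_ne hs', kdc_of_ne hs']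
    ring

/-- The common reindexing `(y, w) := (z − e_ι, z − x)` of the left diagonal: for any one-line letter `Λ` and any
middle index `j`, `Σ_{x,z} ‖x‖₂² Λ(z) (1−δ_{z−x,0})(1−δ_{e−x,0}) 𝓣_{1,j,1}(e−x, z−x, 0) = Σ_y Λ(y+e_ι) LWTT^ι_j(y)`.
[cite: FitznerVanDerHofstad2017, Lemma 5.1 second version (arXiv:1506.07977v2 p. 50); §4.4 (4.65) (p. 43)] -/
theorem tsum_tsum_wt_mul_letter_mul_exit_eq (L : Letters d) (j : LenIdx) (ι : Fin d × Bool) (Λ : Site d → ℝ≥0∞) :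
    ∑' x, ∑' z, wt x * (Λ z * (kdc (z - x) 0 * (kdc (𝐞 ι - x) 0 * L.T (.ge 1) j (.ge 1) (𝐞 ι - x) (z - x) 0)))
      = ∑' y, Λ (y + 𝐞 ι) * diagLWTT L j ι y := by
  rw [ENNReal.tsum_comm]
  have hz : ∑' z, ∑' x, wt x * (Λ z *
        (kdc (z - x) 0 * (kdc (𝐞 ι - x) 0 * L.T (.ge 1) j (.ge 1) (𝐞 ι - x) (z - x) 0)))
      = ∑' y, ∑' x, wt x * (Λ (y + 𝐞 ι) *
        (kdc (y + 𝐞 ι - x) 0 * (kdc (𝐞 ι - x) 0 * L.T (.ge 1) j (.ge 1) (𝐞 ι - x) (y + 𝐞 ι - x) 0))) := by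
    rw [← (Equiv.addRight (𝐞 ι)).tsum_eq]
    simp only [Equiv.coe_addRight]
  rw [hz]
  refine tsum_congr fun y => ?_
  rw [diagLWTT, ← ENNReal.tsum_mul_left]
  have hx : ∑' x, wt x * (Λ (y + 𝐞 ι) *
        (kdc (y + 𝐞 ι - x) 0 * (kdc (𝐞 ι - x) 0 * L.T (.ge 1) j (.ge 1) (𝐞 ι - x) (y + 𝐞 ι - x) 0)))
      = ∑' w, wt (y + 𝐞 ι - w) * (Λ (y + 𝐞 ι) *
        (kdc w 0 * (kdc (w - y) 0 * L.T (.ge 1) j (.ge 1) (w - y) w 0))) := by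
    rw [← (Equiv.subLeft (y + 𝐞 ι)).tsum_eq]
    refine tsum_congr fun w => ?_
    have h1 : y + 𝐞 ι - (y + 𝐞 ι - w) = w := sub_sub_cancel _ _
    have h2 : 𝐞 ι - (y + 𝐞 ι - w) = w - y := by abel
    simp only [Equiv.subLeft_apply, h1, h2]
  rw [hx]
  exact tsum_congr fun w => by rw [diagLIntegrand]; ring

/-- **Normal form of the class-`2` left-trivial diagonal** (an identity, every letter table):
`rawLDiag (blockAbar' L) (blockPEn L) ι 2 = Σ_y Λ^ι_L(y + e_ι) · LWTT^ι_2(y)`.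
[cite: FitznerVanDerHofstad2017, §4.4 (4.65) (arXiv:1506.07977v2 p. 43); Lemma 5.1 second version (p. 50); App. B pp. 73, 78] -/
theorem rawLDiag_two_eq (L : Letters d) (ι : Fin d × Bool) :
    rawLDiag (blockAbar' L) (blockPEn L) ι 2 = ∑' y, diagLLetter L ι (y + 𝐞 ι) * diagLWTT L (.ge 2) ι y := by
  unfold rawLDiag
  simp_rw [blockAbar'_zero_two_diag, blockPEn_two_eq]
  exact tsum_tsum_wt_mul_letter_mul_exit_eq L (.ge 2) ι (diagLLetter L ι)

/-- **Normal form of the class-`1` left-trivial diagonal** (an identity, every letter table):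
`rawLDiag (blockAbar' L) (blockPEn L) ι 1 = Σ_y Λ¹^ι_L(y + e_ι) · LWTT^ι_{1̲}(y)`.
[cite: FitznerVanDerHofstad2017, §4.4 (4.65) (arXiv:1506.07977v2 p. 43); Lemma 5.1 second version (p. 50); App. B pp. 73, 75, 78] -/
theorem rawLDiag_one_eq (L : Letters d) (ι : Fin d × Bool) :
    rawLDiag (blockAbar' L) (blockPEn L) ι 1 = ∑' y, diagLLetterOne L ι (y + 𝐞 ι) * diagLWTT L (.eq 1) ι y := by
  unfold rawLDiag
  simp_rw [blockAbar'_zero_one_diag, blockPEn_one_eq]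
  exact tsum_tsum_wt_mul_letter_mul_exit_eq L (.eq 1) ι (diagLLetterOne L ι)

/-- **The weight split of the left diagonal, inner form** (every `L`, every middle index `j`, an identity in
`[0,∞]`): `LWTT^ι_j(y) + 2 X₋(y) = LW_j(y) + TT_j(y) + 2 X₊(y)`.
[cite: FitznerVanDerHofstad2017, App. C.1 Case a) "‖x‖₂² = ‖w‖₂² + ‖x−w‖₂² + wᵀ(x−w) (sic)" (arXiv:1506.07977v2 p. 79); Lemma 5.1 second version (p. 50)] -/
theorem diagLWTT_inner_split (L : Letters d) (j : LenIdx) (ι : Fin d × Bool) (y : Site d) :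
    diagLWTT L j ι y + 2 * diagLCrossNeg L j ι y = diagLW L j y + diagLTT L j y + 2 * diagLCrossPos L j ι y :=
  tsum_wt_add_stepVec_sub_mul_inner (diagLIntegrand L j y) y ι

/-- The inner form as an inequality: `LWTT^ι_j(y) ≤ LW_j(y) + TT_j(y) + 2 X₊(y)` (the negative cross part dropped).
[cite: FitznerVanDerHofstad2017, App. C.1 Case a) (arXiv:1506.07977v2 p. 79); Lemma 5.1 second version (p. 50)] -/
theorem diagLWTT_le_inner (L : Letters d) (j : LenIdx) (ι : Fin d × Bool) (y : Site d) :
    diagLWTT L j ι y ≤ diagLW L j y + diagLTT L j y + 2 * diagLCrossPos L j ι y :=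
  le_self_add.trans_eq (diagLWTT_inner_split L j ι y)

/-! ## B. Product bounds at `Letters.perc d p` -/

section Perc

variable (p : unitInterval)

/-- `τ_j(0) = 0` when the number of `j` is `≥ 1`: `{v ←j→ v} = ∅` (a path from a point to itself of length `≥ 1`
does not exist). [cite: FitznerVanDerHofstad2017, §4.2 (4.1) (arXiv:1506.07977v2 p. 34)] -/
private theorem perc_tau_zero_of_floor_ne' {j : LenIdx} (hj : LenIdx.floor j ≠ 0) :
    (Letters.perc d p).tau j 0 = 0 := by
  rw [perc_tau, LenIdx.event_self_eq_empty hj, _root_.MeasureTheory.measure_empty]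

/-- **The class-`2` one-line letter, evaluated**: `Λ^ι(z) = p · τ₁(z)` at `Letters.perc` (`τ_{1̲}(e_ι) = p`,
`τ_{≥0}(0) = 1`, `τ₁(−z) = τ₁(z)`). [cite: FitznerVanDerHofstad2017, §4.2 (4.1), (4.7)–(4.8) (arXiv:1506.07977v2 p. 34); App. B row Ā^{ι,0,2} (p. 78)] -/
theorem perc_diagLLetter_eq (ι : Fin d × Bool) (z : Site d) :
    diagLLetter (Letters.perc d p) ι z = ENNReal.ofReal p * (Letters.perc d p).tau (.ge 1) z := by
  rw [diagLLetter_eq, perc_tau_neg, perc_tau_eq_one_stepVec, perc_tau_ge_zero_zero, mul_one, mul_comm]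

/-- `K̃(y) = Σ_ι Λ^ι(y + e_ι)` at `Letters.perc`. [cite: FitznerVanDerHofstad2017, §4.2 (4.1) (arXiv:1506.07977v2 p. 34); App. B row Ā^{ι,0,2} (p. 78)] -/
theorem perc_diagKtilde_eq (y : Site d) :
    diagKtilde (Letters.perc d p) y = ∑ ι : Fin d × Bool, diagLLetter (Letters.perc d p) ι (y + 𝐞 ι) := by
  rw [diagKtilde, perc_p, Finset.mul_sum]
  exact Finset.sum_congr rfl fun ι _ => (perc_diagLLetter_eq p ι _).symm

/-- **The class-`1` one-line letter, product-bounded**: `Λ¹^ι(z) ≤ (1−δ_{z,0}) · τ_{1̲}(z − e_ι) · τ₂(z)` at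
`Letters.perc` — `𝓣_{1̲,1̲,2}(e,z,0) ≤ τ_{1̲}(e) τ_{1̲}(z−e) τ₂(−z)`, `p⁻¹ τ_{1̲}(e) = p⁻¹ p ≤ 1`, `τ₂(−z) = τ₂(z)`, and the
`𝓢_{1̲,1,1̲,1}(e,e,z,0)`-addend VANISHES (`𝓢 ≤ 𝓢*` has the factor `τ_{≥1}(e − e) = τ_{≥1}(0) = 0`).
[cite: FitznerVanDerHofstad2017, §4.2 (4.1), (4.8)–(4.9), (4.14)–(4.17) (arXiv:1506.07977v2 pp. 34–36); App. B Table "definition of A^{ι,a,b}", row a=0,b=1 (p. 75)] -/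
theorem perc_diagLLetterOne_le (ι : Fin d × Bool) (z : Site d) :
    diagLLetterOne (Letters.perc d p) ι z
      ≤ kdc z 0 * ((Letters.perc d p).tau (.eq 1) (z - 𝐞 ι) * (Letters.perc d p).tau (.ge 2) z) := by
  have hS : (Letters.perc d p).S (.eq 1) (.ge 1) (.eq 1) (.ge 1) (𝐞 ι) (𝐞 ι) z 0 = 0 := by
    refine le_antisymm ((perc_S_le_Sst p _ _ _ _ _ _ _ _).trans_eq ?_) zero_le
    simp only [Letters.Sst, Letters.Tst, Letters.Bst, sub_self,
      perc_tau_zero_of_floor_ne' p (j := .ge 1) one_ne_zero, mul_zero, zero_mul]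
  have hT : (Letters.perc d p).T (.eq 1) (.eq 1) (.ge 2) (𝐞 ι) z 0
      ≤ ENNReal.ofReal p * ((Letters.perc d p).tau (.eq 1) (z - 𝐞 ι) * (Letters.perc d p).tau (.ge 2) z) := by
    refine (perc_T_le_Tst p _ _ _ _ _ _).trans_eq ?_
    simp only [Letters.Tst, Letters.Bst, zero_sub, perc_tau_neg, perc_tau_eq_one_stepVec, mul_assoc]
  have hp : (ENNReal.ofReal (p : ℝ))⁻¹ * ENNReal.ofReal (p : ℝ) ≤ 1 := by
    by_cases h0 : ENNReal.ofReal (p : ℝ) = 0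
    · rw [h0, mul_zero]; exact zero_le_one
    · exact (ENNReal.inv_mul_cancel h0 ENNReal.ofReal_ne_top).le
  rw [diagLLetterOne, hS, add_zero, perc_p]
  calc (ENNReal.ofReal (p : ℝ))⁻¹ * (kdc z 0 * (Letters.perc d p).T (.eq 1) (.eq 1) (.ge 2) (𝐞 ι) z 0)
      ≤ (ENNReal.ofReal (p : ℝ))⁻¹ * (kdc z 0 * (ENNReal.ofReal p *
          ((Letters.perc d p).tau (.eq 1) (z - 𝐞 ι) * (Letters.perc d p).tau (.ge 2) z))) :=
        mul_le_mul' le_rfl (mul_le_mul' le_rfl hT)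
    _ = (ENNReal.ofReal (p : ℝ))⁻¹ * ENNReal.ofReal p *
          (kdc z 0 * ((Letters.perc d p).tau (.eq 1) (z - 𝐞 ι) * (Letters.perc d p).tau (.ge 2) z)) := by ring
    _ ≤ 1 * (kdc z 0 * ((Letters.perc d p).tau (.eq 1) (z - 𝐞 ι) * (Letters.perc d p).tau (.ge 2) z)) :=
        mul_le_mul' hp le_rfl
    _ = kdc z 0 * ((Letters.perc d p).tau (.eq 1) (z - 𝐞 ι) * (Letters.perc d p).tau (.ge 2) z) := one_mul _

/-- **Per-direction normal form of class `2` at `Letters.perc`**: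
`rawLDiag (Ā') (P^E−u⃗) ι 2 = p · Σ_y τ₁(y + e_ι) · LWTT^ι_2(y)`.
[cite: FitznerVanDerHofstad2017, Lemma 5.1 second version (arXiv:1506.07977v2 p. 50); §4.4 (4.65) (p. 43)] -/
theorem perc_rawLDiag_two_eq (ι : Fin d × Bool) :
    rawLDiag (blockAbar' (Letters.perc d p)) (blockPEn (Letters.perc d p)) ι 2
      = ENNReal.ofReal p *
          ∑' y, (Letters.perc d p).tau (.ge 1) (y + 𝐞 ι) * diagLWTT (Letters.perc d p) (.ge 2) ι y := by
  rw [rawLDiag_two_eq, ← ENNReal.tsum_mul_left]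
  exact tsum_congr fun y => by rw [perc_diagLLetter_eq, mul_assoc]

/-- **Per-direction normal form of class `1` at `Letters.perc`** (product step on the one-line letter only):
`rawLDiag (Ā') (P^E−u⃗) ι 1 ≤ Σ_y (1−δ_{y+e_ι,0}) τ_{1̲}(y) τ₂(y + e_ι) · LWTT^ι_{1̲}(y)` (`τ_{1̲}(y)` restricts `y` to the
unit vectors). [cite: FitznerVanDerHofstad2017, Lemma 5.1 second version (arXiv:1506.07977v2 p. 50); §4.4 (4.65) (p. 43); §4.2 (4.14)–(4.17) (pp. 35–36)] -/
theorem perc_rawLDiag_one_le (ι : Fin d × Bool) :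
    rawLDiag (blockAbar' (Letters.perc d p)) (blockPEn (Letters.perc d p)) ι 1
      ≤ ∑' y, kdc (y + 𝐞 ι) 0 * ((Letters.perc d p).tau (.eq 1) y * (Letters.perc d p).tau (.ge 2) (y + 𝐞 ι))
          * diagLWTT (Letters.perc d p) (.eq 1) ι y := by
  rw [rawLDiag_one_eq]
  refine ENNReal.tsum_le_tsum fun y => mul_le_mul' ?_ le_rfl
  simpa only [add_sub_cancel_right] using perc_diagLLetterOne_le p ι (y + 𝐞 ι)

/-- The exit-triangle integrand, product-bounded after the reflection `w ↦ y − w`: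
`‖w‖₂² F_j(y; y−w) ≤ τ_j(y) · ‖w‖₂² τ₁(w) τ₁(w−y)` (`𝓣 ≤ 𝓣*`, `τ₁(−w) = τ₁(w)`).
[cite: FitznerVanDerHofstad2017, §4.2 (4.8), (4.14)–(4.17) (arXiv:1506.07977v2 pp. 34–36)] -/
theorem perc_wt_diagLIntegrand_reflect_le (j : LenIdx) (y w : Site d) :
    wt w * diagLIntegrand (Letters.perc d p) j y (y - w)
      ≤ (Letters.perc d p).tau j y
          * (wt w * ((Letters.perc d p).tau (.ge 1) w * (Letters.perc d p).tau (.ge 1) (w - y))) := by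
  have hT : (Letters.perc d p).T (.ge 1) j (.ge 1) (-w) (y - w) 0
      ≤ (Letters.perc d p).tau (.ge 1) (-w) * (Letters.perc d p).tau j y
          * (Letters.perc d p).tau (.ge 1) (w - y) := by
    refine (perc_T_le_Tst p _ _ _ _ _ _).trans_eq ?_
    simp only [Letters.Tst, Letters.Bst, sub_neg_eq_add, sub_add_cancel, zero_sub, neg_sub]
  have hk : diagLIntegrand (Letters.perc d p) j y (y - w)
      ≤ (Letters.perc d p).T (.ge 1) j (.ge 1) (-w) (y - w) 0 := by
    rw [diagLIntegrand, sub_sub_cancel_left]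
    calc kdc (y - w) 0 * (kdc (-w) 0 * (Letters.perc d p).T (.ge 1) j (.ge 1) (-w) (y - w) 0)
        ≤ 1 * (1 * (Letters.perc d p).T (.ge 1) j (.ge 1) (-w) (y - w) 0) :=
          mul_le_mul' (kdc_le_one _ _) (mul_le_mul' (kdc_le_one _ _) le_rfl)
      _ = (Letters.perc d p).T (.ge 1) j (.ge 1) (-w) (y - w) 0 := by rw [one_mul, one_mul]
  calc wt w * diagLIntegrand (Letters.perc d p) j y (y - w)
      ≤ wt w * ((Letters.perc d p).tau (.ge 1) (-w) * (Letters.perc d p).tau j y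
          * (Letters.perc d p).tau (.ge 1) (w - y)) := mul_le_mul' le_rfl (hk.trans hT)
    _ = (Letters.perc d p).tau j y
          * (wt w * ((Letters.perc d p).tau (.ge 1) w * (Letters.perc d p).tau (.ge 1) (w - y))) := by
        rw [perc_tau_neg]
        ring

/-- **`LW_j(y) ≤ τ_j(y) · Φ(y)`**, `Φ(y) = Σ_w ‖w‖₂² τ₁(w) τ₁(w − y)` (the right twin's `wtOpenBubbleAt`).
[cite: FitznerVanDerHofstad2017, §4.2 (4.14)–(4.17) (arXiv:1506.07977v2 pp. 35–36); Lemma 5.1 second version (p. 50); App. B "Building blocks with weight" (p. 78)] -/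
theorem perc_diagLW_le (j : LenIdx) (y : Site d) :
    diagLW (Letters.perc d p) j y ≤ (Letters.perc d p).tau j y * wtOpenBubbleAt (Letters.perc d p) y := by
  have hrefl : diagLW (Letters.perc d p) j y = ∑' w, wt w * diagLIntegrand (Letters.perc d p) j y (y - w) := by
    rw [diagLW, ← (Equiv.subLeft y).tsum_eq]
    exact tsum_congr fun w => by simp only [Equiv.subLeft_apply, sub_sub_cancel]
  rw [hrefl, wtOpenBubbleAt, ← ENNReal.tsum_mul_left]
  exact ENNReal.tsum_le_tsum fun w => perc_wt_diagLIntegrand_reflect_le p j y w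

/-- The exit-triangle integrand, product-bounded: `F_j(y;w) ≤ τ_j(y) · τ₁(w) τ₁(w−y)`.
[cite: FitznerVanDerHofstad2017, §4.2 (4.8), (4.14)–(4.17) (arXiv:1506.07977v2 pp. 34–36)] -/
theorem perc_diagLIntegrand_le (j : LenIdx) (y w : Site d) :
    diagLIntegrand (Letters.perc d p) j y w
      ≤ (Letters.perc d p).tau j y * ((Letters.perc d p).tau (.ge 1) w * (Letters.perc d p).tau (.ge 1) (w - y)) := by
  have hT : (Letters.perc d p).T (.ge 1) j (.ge 1) (w - y) w 0
      ≤ (Letters.perc d p).tau (.ge 1) (w - y) * (Letters.perc d p).tau j y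
          * (Letters.perc d p).tau (.ge 1) (-w) := by
    refine (perc_T_le_Tst p _ _ _ _ _ _).trans_eq ?_
    simp only [Letters.Tst, Letters.Bst, sub_sub_cancel, zero_sub]
  rw [diagLIntegrand]
  calc kdc w 0 * (kdc (w - y) 0 * (Letters.perc d p).T (.ge 1) j (.ge 1) (w - y) w 0)
      ≤ 1 * (1 * ((Letters.perc d p).tau (.ge 1) (w - y) * (Letters.perc d p).tau j y
          * (Letters.perc d p).tau (.ge 1) (-w))) :=
        mul_le_mul' (kdc_le_one _ _) (mul_le_mul' (kdc_le_one _ _) hT)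
    _ = (Letters.perc d p).tau j y
          * ((Letters.perc d p).tau (.ge 1) w * (Letters.perc d p).tau (.ge 1) (w - y)) := by
        rw [one_mul, one_mul, perc_tau_neg]
        ring

/-- **`TT_j(y) ≤ τ_j(y) · Φ⁰(y)`** (the pointwise open bubble `openBubbleAt`).
[cite: FitznerVanDerHofstad2017, §4.2 (4.14)–(4.17) (arXiv:1506.07977v2 pp. 35–36); Lemma 5.1 second version (p. 50)] -/
theorem perc_diagLTT_le (j : LenIdx) (y : Site d) :
    diagLTT (Letters.perc d p) j y ≤ (Letters.perc d p).tau j y * openBubbleAt (Letters.perc d p) y := by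
  rw [diagLTT, openBubbleAt, ← ENNReal.tsum_mul_left]
  exact ENNReal.tsum_le_tsum fun w => perc_diagLIntegrand_le p j y w

/-- **The structural-drop form** (pairing against the product majorant, negative part dropped):
`LWTT^ι_j(y) ≤ τ_j(y) · (Φ(y) + (1 + ⟨y,e_ι⟩₊) · Φ⁰(y))` — the weight lands on the open bubble's own line, the
companion is linear in `⟨y,e_ι⟩₊`.
[cite: FitznerVanDerHofstad2017, App. C.1 Case a) "… and spatial symmetry" (arXiv:1506.07977v2 p. 79); §4.2 (4.14)–(4.17) (pp. 35–36); Lemma 5.1 second version (p. 50)] -/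
theorem perc_diagLWTT_le_drop (j : LenIdx) (ι : Fin d × Bool) (y : Site d) :
    diagLWTT (Letters.perc d p) j ι y ≤ (Letters.perc d p).tau j y *
      (wtOpenBubbleAt (Letters.perc d p) y
        + ENNReal.ofReal (1 + max (dirDot ι y) 0) * openBubbleAt (Letters.perc d p) y) := by
  rw [wtOpenBubbleAt]
  set G : Site d → ℝ≥0∞ := fun w => (Letters.perc d p).tau (.ge 1) w * (Letters.perc d p).tau (.ge 1) (w - y)
    with hGdef
  have hG : ∀ w, G (y - w) = G w := fun w => by
    simp only [hGdef, sub_sub_cancel_left, perc_tau_neg]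
    rw [← perc_tau_neg p (.ge 1) (y - w), neg_sub, mul_comm]
  have h1 : diagLWTT (Letters.perc d p) j ι y
      ≤ (Letters.perc d p).tau j y * ∑' w, wt (y + 𝐞 ι - w) * G w := by
    rw [diagLWTT, ← ENNReal.tsum_mul_left]
    refine ENNReal.tsum_le_tsum fun w => ?_
    calc wt (y + 𝐞 ι - w) * diagLIntegrand (Letters.perc d p) j y w
        ≤ wt (y + 𝐞 ι - w) * ((Letters.perc d p).tau j y * G w) :=
          mul_le_mul' le_rfl (perc_diagLIntegrand_le p j y w)
      _ = (Letters.perc d p).tau j y * (wt (y + 𝐞 ι - w) * G w) := by ring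
  have h2 : ∑' w, wt (y + 𝐞 ι - w) * G w
      ≤ ∑' w, wt w * G w + ENNReal.ofReal (1 + max (dirDot ι y) 0) * ∑' w, G w :=
    le_self_add.trans_eq (tsum_wt_add_stepVec_sub_mul G y hG ι)
  exact h1.trans (mul_le_mul' le_rfl h2)

/-- **The direction-summed class-`2` left diagonal in INNER form** (an identity at `Letters.perc`): with
`c^ι(y) := p τ₁(y + e_ι)` and `K̃(y) = Σ_ι c^ι(y)`,
`Σ_ι rawLDiag … ι 2 + 2 Σ_ι Σ_y c^ι(y) X₋(y) = Σ_y K̃(y) (LW_2 + TT_2)(y) + 2 Σ_ι Σ_y c^ι(y) X₊(y)`.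
[cite: FitznerVanDerHofstad2017, Lemma 5.1 second version (arXiv:1506.07977v2 p. 50); §4.4 (4.65) (p. 43); App. C.1 Case a) (p. 79)] -/
theorem perc_sum_rawLDiag_two_inner_split :
    ∑ ι : Fin d × Bool, rawLDiag (blockAbar' (Letters.perc d p)) (blockPEn (Letters.perc d p)) ι 2
      + 2 * ∑ ι : Fin d × Bool, ∑' y, (ENNReal.ofReal p * (Letters.perc d p).tau (.ge 1) (y + 𝐞 ι))
          * diagLCrossNeg (Letters.perc d p) (.ge 2) ι y
      = ∑' y, diagKtilde (Letters.perc d p) y * (diagLW (Letters.perc d p) (.ge 2) y + diagLTT (Letters.perc d p) (.ge 2) y)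
        + 2 * ∑ ι : Fin d × Bool, ∑' y, (ENNReal.ofReal p * (Letters.perc d p).tau (.ge 1) (y + 𝐞 ι))
          * diagLCrossPos (Letters.perc d p) (.ge 2) ι y := by
  set c : Fin d × Bool → Site d → ℝ≥0∞ := fun ι y => ENNReal.ofReal p * (Letters.perc d p).tau (.ge 1) (y + 𝐞 ι)
    with hc
  have h1 : ∀ ι, rawLDiag (blockAbar' (Letters.perc d p)) (blockPEn (Letters.perc d p)) ι 2
      = ∑' y, c ι y * diagLWTT (Letters.perc d p) (.ge 2) ι y := fun ι => by
    rw [perc_rawLDiag_two_eq, ← ENNReal.tsum_mul_left]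
    exact tsum_congr fun y => by rw [hc, mul_assoc]
  have h2 : ∀ ι y, c ι y * diagLWTT (Letters.perc d p) (.ge 2) ι y
        + 2 * (c ι y * diagLCrossNeg (Letters.perc d p) (.ge 2) ι y)
      = c ι y * (diagLW (Letters.perc d p) (.ge 2) y + diagLTT (Letters.perc d p) (.ge 2) y)
        + 2 * (c ι y * diagLCrossPos (Letters.perc d p) (.ge 2) ι y) := fun ι y => by
    calc c ι y * diagLWTT (Letters.perc d p) (.ge 2) ι y
          + 2 * (c ι y * diagLCrossNeg (Letters.perc d p) (.ge 2) ι y)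
        = c ι y * (diagLWTT (Letters.perc d p) (.ge 2) ι y + 2 * diagLCrossNeg (Letters.perc d p) (.ge 2) ι y) := by
          ring
      _ = c ι y * (diagLW (Letters.perc d p) (.ge 2) y + diagLTT (Letters.perc d p) (.ge 2) y
          + 2 * diagLCrossPos (Letters.perc d p) (.ge 2) ι y) := by rw [diagLWTT_inner_split]
      _ = c ι y * (diagLW (Letters.perc d p) (.ge 2) y + diagLTT (Letters.perc d p) (.ge 2) y)
          + 2 * (c ι y * diagLCrossPos (Letters.perc d p) (.ge 2) ι y) := by ring
  have hK : ∀ H : Site d → ℝ≥0∞,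
      ∑ ι : Fin d × Bool, ∑' y, c ι y * H y = ∑' y, diagKtilde (Letters.perc d p) y * H y := fun H => by
    rw [← tsum_finsetSum]
    refine tsum_congr fun y => ?_
    rw [diagKtilde, perc_p, Finset.mul_sum, Finset.sum_mul]
  calc ∑ ι : Fin d × Bool, rawLDiag (blockAbar' (Letters.perc d p)) (blockPEn (Letters.perc d p)) ι 2
        + 2 * ∑ ι : Fin d × Bool, ∑' y, c ι y * diagLCrossNeg (Letters.perc d p) (.ge 2) ι y
      = ∑ ι : Fin d × Bool, (∑' y, c ι y * diagLWTT (Letters.perc d p) (.ge 2) ι y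
          + 2 * ∑' y, c ι y * diagLCrossNeg (Letters.perc d p) (.ge 2) ι y) := by
        rw [Finset.sum_add_distrib, Finset.mul_sum]
        exact congrArg₂ (· + ·) (Finset.sum_congr rfl fun ι _ => h1 ι) rfl
    _ = ∑ ι : Fin d × Bool, ∑' y, (c ι y * diagLWTT (Letters.perc d p) (.ge 2) ι y
          + 2 * (c ι y * diagLCrossNeg (Letters.perc d p) (.ge 2) ι y)) :=
        Finset.sum_congr rfl fun ι _ => by rw [ENNReal.tsum_add, ENNReal.tsum_mul_left]
    _ = ∑ ι : Fin d × Bool, ∑' y, (c ι y * (diagLW (Letters.perc d p) (.ge 2) y + diagLTT (Letters.perc d p) (.ge 2) y)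
          + 2 * (c ι y * diagLCrossPos (Letters.perc d p) (.ge 2) ι y)) :=
        Finset.sum_congr rfl fun ι _ => tsum_congr fun y => h2 ι y
    _ = ∑ ι : Fin d × Bool, (∑' y, c ι y * (diagLW (Letters.perc d p) (.ge 2) y + diagLTT (Letters.perc d p) (.ge 2) y)
          + 2 * ∑' y, c ι y * diagLCrossPos (Letters.perc d p) (.ge 2) ι y) :=
        Finset.sum_congr rfl fun ι _ => by rw [ENNReal.tsum_add, ENNReal.tsum_mul_left]
    _ = ∑' y, diagKtilde (Letters.perc d p) y * (diagLW (Letters.perc d p) (.ge 2) y + diagLTT (Letters.perc d p) (.ge 2) y)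
          + 2 * ∑ ι : Fin d × Bool, ∑' y, c ι y * diagLCrossPos (Letters.perc d p) (.ge 2) ι y := by
        rw [Finset.sum_add_distrib, Finset.mul_sum, hK]

end Perc

end Literature.Probability.FitznerVanDerHofstad2017

end
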